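import Mathlib
import Literature.Probability.Percolation.Percolation
import Literature.Probability.Percolation.SitePaths
import Literature.Probability.LatticeModels.TriangularLattice
import Literature.Probability.LatticeModels.TriangularLatticeProofs
import Summits.CriticalPhenomena.CardyFormulaZ2.Theorems.CardyMagicRigidityHexSegmentDefs
import Summits.CriticalPhenomena.CardyFormulaZ2.Theorems.CardyMagicRigidityLoopLimitZ2EqTSiteEndCoords
import HarnessLib

/-!
# Stub `stub_siteEnd` (S2) of line `Sketch`, crux `LoopLimitZ2EqT` (stmt-CriticalPhenomena-4833):
# the arena identity at the level of clusters

Helper file (`--supports stmt-CriticalPhenomena-4833`). By `siteEnd_refine_upEdge_eq`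
(`CardyMagicRigidityLoopLimitZ2EqTSiteEndLaw.lean`) the fine site configuration of the segment
model at `t = 0` is the **blow-up** `β τ := {v | (∀ i, 2 ∣ v i) ∨ ⌊v/2⌋ ∈ τ}` of the fair-coin
layer `τ` (a site configuration on `𝕋`): the block of the cell `x` is `2x + {0,1}²`, its
**corner** `2x` (a doubled original vertex) is always open and its three other sites (the
midpoints of the edges of the up-triangle at `x`), among them the **centre** `2x + (1,1)`, are
open iff `x ∈ τ`. This file proves the combinatorial dictionary between the site clusters of
`β τ` on the fine triangular lattice and the site clusters of `τ` on `𝕋` (paths = `PathIn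
triGraph`, `SitePaths.lean`), i.e. the classical "arena identity" (site percolation on `𝕋` =
all-or-nothing percolation of the up-triangles) read through the half-mesh refinement:

* (from `CardyMagicRigidityLoopLimitZ2EqTSiteEndCoords.lean`) `siteEnd_half_eq_or_adj` — the
  halving map `v ↦ ⌊v/2⌋` is a weak homomorphism of `𝕋`; `siteEnd_not_adj_of_even` (two corners
  are never adjacent), `siteEnd_half_of_adj_even` (the neighbours of the corner `2z` halve into
  the triangle `{z, z - e₀, z - e₁}` of cells around the original vertex `z`);
* `siteEnd_pathIn_ctr_of_adj` — adjacent cells have their block centres joined by a fine path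
  through non-corner sites of the two blocks;
* **`siteEnd_pathIn_blowup_iff`** — cells `x, y` are joined by a path of OPEN cells of `τ` iff
  their block centres are joined by a path of open fine sites of `β τ`;
* **`siteEnd_pathIn_compl_blowup_iff`** — the same for CLOSED cells and closed fine sites;
* `siteEnd_pathIn_blowup_ctr`, `siteEnd_pathIn_compl_blowup_ctr` — every non-corner fine site
  is joined, within its colour, to the centre of its block; `siteEnd_corner_isolated_iff` — the
  corner `2z` is an isolated open fine site (all six neighbours closed) iff
  `z, z - e₀, z - e₁ ∉ τ`, and otherwise it hangs on the open fine cluster of a block centre.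

Consequently the closed fine clusters are exactly the blow-ups minus corners of the closed
clusters of `τ`, and the open fine clusters are the blow-ups of the open clusters of `τ` with
pendant corners attached, plus isolated corners (dust): the cluster-level input of the loop
dictionary of `CardyMagicRigidityLoopLimitZ2EqTSiteEndAssembly.lean`.
-/

noncomputable section

open Set

namespace Summit.CriticalPhenomena.CardyFormulaZ2.Cruxes.LoopLimitZ2EqT.HexSegment

open Literature.Probability.Percolation Literature.Probability.LatticeModels

/-! ### Blocks, corners and centres -/

/-- The centre `2x + (1,1)` of the block of the cell `x` halves to `x`. -/
theorem siteEnd_half_ctr (x : Site 2) : (fun i => (2 * x i + 1) / 2) = x := by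
  funext i; omega

/-- The centre of a block is not a doubled vertex. -/
theorem siteEnd_ctr_not_even (x : Site 2) : ¬ ∀ i : Fin 2, (2 : ℤ) ∣ (2 * x i + 1) := fun h => by
  obtain ⟨c, hc⟩ := h 0; omega

/-- The centre of the block of `x` is open in the blow-up iff `x ∈ τ`. -/
theorem siteEnd_ctr_mem_blowup_iff (τ : SiteConfig (Site 2)) (x : Site 2) :
    (fun i => 2 * x i + 1 : Site 2) ∈ {v : Site 2 | (∀ i, (2 : ℤ) ∣ v i) ∨ (fun i => v i / 2) ∈ τ} ↔
      x ∈ τ := by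
  simp only [mem_setOf_eq, siteEnd_half_ctr]
  exact ⟨fun h => h.resolve_left (siteEnd_ctr_not_even x), Or.inr⟩

/-- A non-corner fine site is open in the blow-up iff its half-cell is in `τ`. -/
theorem siteEnd_mem_blowup_iff_of_not_even {τ : SiteConfig (Site 2)} {v : Site 2}
    (hv : ¬ ∀ i, (2 : ℤ) ∣ v i) :
    v ∈ {v : Site 2 | (∀ i, (2 : ℤ) ∣ v i) ∨ (fun i => v i / 2) ∈ τ} ↔ (fun i => v i / 2) ∈ τ :=
  ⟨fun h => h.resolve_left hv, Or.inr⟩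

/-- A closed fine site of the blow-up is a non-corner whose half-cell is closed. -/
theorem siteEnd_not_mem_blowup_iff (τ : SiteConfig (Site 2)) (v : Site 2) :
    v ∉ {v : Site 2 | (∀ i, (2 : ℤ) ∣ v i) ∨ (fun i => v i / 2) ∈ τ} ↔
      (¬ ∀ i, (2 : ℤ) ∣ v i) ∧ (fun i => v i / 2) ∉ τ := by
  simp only [mem_setOf_eq, not_or]

/-! ### Fine paths between block centres along one coarse edge -/

/-- **One coarse step, three forward directions.** For `b = a + e₀`, `a + e₁` or `a + e₀ - e₁`
there is a fine path from the centre of the block of `a` to the centre of the block of `b`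
through non-corner sites of the two blocks only, hence inside any set `A` containing all
non-corner fine sites halving to `a` or `b`. -/
theorem siteEnd_pathIn_ctr_of_forward {A : Set (Site 2)} {a b : Site 2}
    (hA : ∀ u : Site 2, (¬ ∀ i, (2 : ℤ) ∣ u i) →
      ((fun i => u i / 2) = a ∨ (fun i => u i / 2) = b) → u ∈ A)
    (h : (b 0 = a 0 + 1 ∧ b 1 = a 1) ∨ (b 0 = a 0 ∧ b 1 = a 1 + 1) ∨
      (b 0 = a 0 + 1 ∧ b 1 = a 1 - 1)) :
    PathIn triGraph A (fun i => 2 * a i + 1) (fun i => 2 * b i + 1) := by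
  have hca : (fun i => 2 * a i + 1 : Site 2) ∈ A :=
    hA _ (siteEnd_ctr_not_even a) (Or.inl (siteEnd_half_ctr a))
  have hcb : (fun i => 2 * b i + 1 : Site 2) ∈ A :=
    hA _ (siteEnd_ctr_not_even b) (Or.inr (siteEnd_half_ctr b))
  rcases h with h | h | h
  · -- east: 2a+(1,1) → 2a+(2,1) → 2a+(3,1) = 2b+(1,1)
    set m : Site 2 := ![2 * a 0 + 2, 2 * a 1 + 1] with hm
    have hm0 : m 0 = 2 * a 0 + 2 := rfl
    have hm1 : m 1 = 2 * a 1 + 1 := rfl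
    have hmA : m ∈ A := hA m (fun he => by obtain ⟨c, hc⟩ := he 1; omega)
      (Or.inr (siteEnd_half_eq_of_coords (by omega) (by omega)))
    exact (PathIn.of_adj hca hmA (siteEnd_adj_of_coords' rfl rfl hm0 hm1 (by omega))).tail
      (siteEnd_adj_of_coords' hm0 hm1 rfl rfl (by omega)) hcb
  · -- north: 2a+(1,1) → 2a+(1,2) → 2a+(1,3)
    set m : Site 2 := ![2 * a 0 + 1, 2 * a 1 + 2] with hm
    have hm0 : m 0 = 2 * a 0 + 1 := rfl
    have hm1 : m 1 = 2 * a 1 + 2 := rfl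
    have hmA : m ∈ A := hA m (fun he => by obtain ⟨c, hc⟩ := he 0; omega)
      (Or.inr (siteEnd_half_eq_of_coords (by omega) (by omega)))
    exact (PathIn.of_adj hca hmA (siteEnd_adj_of_coords' rfl rfl hm0 hm1 (by omega))).tail
      (siteEnd_adj_of_coords' hm0 hm1 rfl rfl (by omega)) hcb
  · -- south-east: 2a+(1,1) → 2a+(1,0) → 2a+(2,-1) → 2a+(3,-1)
    set m : Site 2 := ![2 * a 0 + 1, 2 * a 1] with hm
    set m' : Site 2 := ![2 * a 0 + 2, 2 * a 1 - 1] with hm'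
    have hm0 : m 0 = 2 * a 0 + 1 := rfl
    have hm1 : m 1 = 2 * a 1 := rfl
    have hm'0 : m' 0 = 2 * a 0 + 2 := rfl
    have hm'1 : m' 1 = 2 * a 1 - 1 := rfl
    have hmA : m ∈ A := hA m (fun he => by obtain ⟨c, hc⟩ := he 0; omega)
      (Or.inl (siteEnd_half_eq_of_coords (by omega) (by omega)))
    have hm'A : m' ∈ A := hA m' (fun he => by obtain ⟨c, hc⟩ := he 1; omega)
      (Or.inr (siteEnd_half_eq_of_coords (by omega) (by omega)))
    exact ((PathIn.of_adj hca hmA (siteEnd_adj_of_coords' rfl rfl hm0 hm1 (by omega))).tail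
      (siteEnd_adj_of_coords' hm0 hm1 hm'0 hm'1 (by omega)) hm'A).tail
      (siteEnd_adj_of_coords' hm'0 hm'1 rfl rfl (by omega)) hcb

/-- **One coarse step, all six directions**: adjacent cells have their block centres joined by
a fine path inside any set containing all non-corner sites halving to one of them. -/
theorem siteEnd_pathIn_ctr_of_adj {A : Set (Site 2)} {a b : Site 2}
    (hA : ∀ u : Site 2, (¬ ∀ i, (2 : ℤ) ∣ u i) →
      ((fun i => u i / 2) = a ∨ (fun i => u i / 2) = b) → u ∈ A)
    (h : triGraph.Adj a b) :
    PathIn triGraph A (fun i => 2 * a i + 1) (fun i => 2 * b i + 1) := by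
  have hA' : ∀ u : Site 2, (¬ ∀ i, (2 : ℤ) ∣ u i) →
      ((fun i => u i / 2) = b ∨ (fun i => u i / 2) = a) → u ∈ A :=
    fun u hu hab => hA u hu hab.symm
  rcases triGraph_adj_apply h with h | h | h | h | h | h
  · exact siteEnd_pathIn_ctr_of_forward hA (Or.inl h)
  · exact siteEnd_pathIn_ctr_of_forward hA (Or.inr (Or.inl h))
  · exact (siteEnd_pathIn_ctr_of_forward hA' (Or.inl h)).symm
  · exact (siteEnd_pathIn_ctr_of_forward hA' (Or.inr (Or.inl h))).symm
  · exact siteEnd_pathIn_ctr_of_forward hA (Or.inr (Or.inr h))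
  · exact (siteEnd_pathIn_ctr_of_forward hA' (Or.inr (Or.inr h))).symm

/-! ### The cluster dictionary: coarse paths to fine paths -/

/-- **Open clusters, coarse ⇒ fine.** A path of open cells of `τ` lifts to a path of open fine
sites of the blow-up between the block centres. -/
theorem siteEnd_pathIn_blowup_of_pathIn {τ : SiteConfig (Site 2)} {x y : Site 2}
    (h : PathIn triGraph τ x y) :
    PathIn triGraph {v : Site 2 | (∀ i, (2 : ℤ) ∣ v i) ∨ (fun i => v i / 2) ∈ τ}
      (fun i => 2 * x i + 1) (fun i => 2 * y i + 1) := by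
  obtain ⟨hx, h⟩ := h
  induction h with
  | refl => exact PathIn.refl ((siteEnd_ctr_mem_blowup_iff τ x).2 hx)
  | @tail b c _ hbc ih =>
    have hb : b ∈ τ := (siteEnd_ctr_mem_blowup_iff τ b).1 ih.right_mem
    refine ih.trans (siteEnd_pathIn_ctr_of_adj (fun u _ hu => Or.inr ?_) hbc.1)
    rcases hu with hu | hu
    · rw [hu]; exact hb
    · rw [hu]; exact hbc.2

/-- **Closed clusters, coarse ⇒ fine.** A path of closed cells lifts to a path of closed fine
sites of the blow-up between the block centres (the lift avoids the always-open corners). -/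
theorem siteEnd_pathIn_compl_blowup_of_pathIn {τ : SiteConfig (Site 2)} {x y : Site 2}
    (h : PathIn triGraph τᶜ x y) :
    PathIn triGraph {v : Site 2 | (∀ i, (2 : ℤ) ∣ v i) ∨ (fun i => v i / 2) ∈ τ}ᶜ
      (fun i => 2 * x i + 1) (fun i => 2 * y i + 1) := by
  obtain ⟨hx, h⟩ := h
  induction h with
  | refl =>
    refine PathIn.refl ?_
    rw [mem_compl_iff, siteEnd_ctr_mem_blowup_iff]
    exact hx
  | @tail b c _ hbc ih =>
    have hb : b ∉ τ := by
      have := ih.right_mem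
      rwa [mem_compl_iff, siteEnd_ctr_mem_blowup_iff] at this
    refine ih.trans (siteEnd_pathIn_ctr_of_adj (fun u hu hu' => ?_) hbc.1)
    rw [mem_compl_iff, siteEnd_not_mem_blowup_iff]
    refine ⟨hu, ?_⟩
    rcases hu' with hu' | hu'
    · rw [hu']; exact hb
    · rw [hu']; exact hbc.2

/-! ### The cluster dictionary: fine paths to coarse paths -/

/-- **Closed clusters, fine ⇒ coarse.** Along a path of closed fine sites (all non-corners) the
half-cells form a path of closed cells (`siteEnd_half_eq_or_adj`). -/
theorem siteEnd_pathIn_of_pathIn_compl_blowup {τ : SiteConfig (Site 2)} {u w : Site 2}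
    (h : PathIn triGraph {v : Site 2 | (∀ i, (2 : ℤ) ∣ v i) ∨ (fun i => v i / 2) ∈ τ}ᶜ u w) :
    PathIn triGraph τᶜ (fun i => u i / 2) (fun i => w i / 2) := by
  obtain ⟨hu, h⟩ := h
  have hu' := (siteEnd_not_mem_blowup_iff τ u).1 hu
  induction h with
  | refl => exact PathIn.refl hu'.2
  | @tail b c _ hbc ih =>
    have hc := (siteEnd_not_mem_blowup_iff τ c).1 hbc.2
    exact ih.trans (PathIn.of_eq_or_adj ih.right_mem hc.2 (siteEnd_half_eq_or_adj hbc.1))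

/-- **Open clusters, fine ⇒ coarse.** Along a path of open fine sites starting at a non-corner,
the half-cells of the non-corner sites visited form a path of open cells; a corner `2z` on the
way is entered from and left towards non-corner sites whose half-cells lie in the triangle
`{z, z - e₀, z - e₁}` (`siteEnd_half_of_adj_even`), so it can be skipped
(`siteEnd_eq_or_adj_of_near`; two corners are never adjacent, `siteEnd_not_adj_of_even`). -/
theorem siteEnd_pathIn_of_pathIn_blowup {τ : SiteConfig (Site 2)} {u w : Site 2}
    (h : PathIn triGraph {v : Site 2 | (∀ i, (2 : ℤ) ∣ v i) ∨ (fun i => v i / 2) ∈ τ} u w)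
    (hu : ¬ ∀ i, (2 : ℤ) ∣ u i) (hw : ¬ ∀ i, (2 : ℤ) ∣ w i) :
    PathIn triGraph τ (fun i => u i / 2) (fun i => w i / 2) := by
  obtain ⟨huA, h⟩ := h
  have huτ : (fun i => u i / 2) ∈ τ := huA.resolve_left hu
  -- invariant along the path
  suffices H : (¬ (∀ i, (2 : ℤ) ∣ w i) → PathIn triGraph τ (fun i => u i / 2) (fun i => w i / 2)) ∧
      ((∀ i, (2 : ℤ) ∣ w i) → ∃ c : Site 2, ((c 0 = w 0 / 2 ∧ c 1 = w 1 / 2) ∨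
        (c 0 = w 0 / 2 - 1 ∧ c 1 = w 1 / 2) ∨ (c 0 = w 0 / 2 ∧ c 1 = w 1 / 2 - 1)) ∧
        PathIn triGraph τ (fun i => u i / 2) c) from H.1 hw
  clear hw
  induction h with
  | refl => exact ⟨fun _ => PathIn.refl huτ, fun he => absurd he hu⟩
  | @tail b c _ hbc ih =>
    obtain ⟨ih₁, ih₂⟩ := ih
    by_cases hb : ∀ i, (2 : ℤ) ∣ b i
    · -- `b` is a corner, so `c` is not
      have hc : ¬ ∀ i, (2 : ℤ) ∣ c i := fun hc => siteEnd_not_adj_of_even hb hc hbc.1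
      refine ⟨fun _ => ?_, fun hc' => absurd hc' hc⟩
      obtain ⟨d, hd, hp⟩ := ih₂ hb
      have hcτ : (fun i => c i / 2) ∈ τ := hbc.2.resolve_left hc
      have hc' := siteEnd_half_of_adj_even hbc.1.symm hb
      exact hp.trans (PathIn.of_eq_or_adj hp.right_mem hcτ
          (siteEnd_eq_or_adj_of_near (z := fun i => b i / 2) hd hc'))
    · have hp := ih₁ hb
      by_cases hc : ∀ i, (2 : ℤ) ∣ c i
      · refine ⟨fun hc' => absurd hc hc', fun _ => ⟨fun i => b i / 2, ?_, hp⟩⟩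
        exact siteEnd_half_of_adj_even hbc.1 hc
      · refine ⟨fun _ => ?_, fun hc' => absurd hc' hc⟩
        have hcτ : (fun i => c i / 2) ∈ τ := hbc.2.resolve_left hc
        exact hp.trans (PathIn.of_eq_or_adj hp.right_mem hcτ (siteEnd_half_eq_or_adj hbc.1))

/-! ### The arena identity at the level of clusters -/

/-- **(3b) Arena identity, open clusters.** Two cells are joined by a path of open cells of `τ`
iff the centres of their blocks are joined by a path of open fine sites of the blow-up: the open
fine clusters met with the block centres are exactly the open site clusters of `τ` on `𝕋`
(the remaining open fine sites being corners, pendant or isolated). -/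
theorem siteEnd_pathIn_blowup_iff : ∀ (τ : SiteConfig (Site 2)) (x y : Site 2),
    PathIn triGraph {v : Site 2 | (∀ i, (2 : ℤ) ∣ v i) ∨ (fun i => v i / 2) ∈ τ}
      (fun i => 2 * x i + 1) (fun i => 2 * y i + 1) ↔ PathIn triGraph τ x y := by
  intro τ x y
  refine ⟨fun h => ?_, siteEnd_pathIn_blowup_of_pathIn⟩
  have := siteEnd_pathIn_of_pathIn_blowup h (siteEnd_ctr_not_even x) (siteEnd_ctr_not_even y)
  rwa [siteEnd_half_ctr, siteEnd_half_ctr] at this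

/-- **(3b) Arena identity, closed clusters.** Two cells are joined by a path of closed cells of
`τ` iff the centres of their blocks are joined by a path of closed fine sites of the blow-up:
the closed fine clusters are exactly the blow-ups (minus corners) of the closed site clusters
of `τ`. -/
theorem siteEnd_pathIn_compl_blowup_iff : ∀ (τ : SiteConfig (Site 2)) (x y : Site 2),
    PathIn triGraph {v : Site 2 | (∀ i, (2 : ℤ) ∣ v i) ∨ (fun i => v i / 2) ∈ τ}ᶜ
      (fun i => 2 * x i + 1) (fun i => 2 * y i + 1) ↔ PathIn triGraph τᶜ x y := by
  intro τ x y
  refine ⟨fun h => ?_, siteEnd_pathIn_compl_blowup_of_pathIn⟩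
  have := siteEnd_pathIn_of_pathIn_compl_blowup h
  rwa [siteEnd_half_ctr, siteEnd_half_ctr] at this

/-- **Every closed fine site is joined, through closed fine sites, to the centre of its block**
(the three non-corner sites of a block form a fine triangle). -/
theorem siteEnd_pathIn_compl_blowup_ctr {τ : SiteConfig (Site 2)} {v : Site 2}
    (hv : v ∉ {v : Site 2 | (∀ i, (2 : ℤ) ∣ v i) ∨ (fun i => v i / 2) ∈ τ}) :
    PathIn triGraph {v : Site 2 | (∀ i, (2 : ℤ) ∣ v i) ∨ (fun i => v i / 2) ∈ τ}ᶜ v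
      (fun i => 2 * (v i / 2) + 1) := by
  have hv' := (siteEnd_not_mem_blowup_iff τ v).1 hv
  have hne : ¬ (v 0 % 2 = 0 ∧ v 1 % 2 = 0) := fun h => hv'.1 fun i => by
    fin_cases i
    · exact Int.dvd_of_emod_eq_zero h.1
    · exact Int.dvd_of_emod_eq_zero h.2
  refine PathIn.of_eq_or_adj hv ?_ (siteEnd_eq_or_adj_of_coords' rfl rfl rfl rfl ?_)
  · rw [mem_compl_iff, siteEnd_not_mem_blowup_iff]
    refine ⟨siteEnd_ctr_not_even _, ?_⟩
    rw [siteEnd_half_ctr]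
    exact hv'.2
  · have h0 := Int.emod_two_eq_zero_or_one (v 0)
    have h1 := Int.emod_two_eq_zero_or_one (v 1)
    omega

/-- **Every open non-corner fine site is joined, through open fine sites, to the centre of its
block.** -/
theorem siteEnd_pathIn_blowup_ctr {τ : SiteConfig (Site 2)} {v : Site 2}
    (hv : v ∈ {v : Site 2 | (∀ i, (2 : ℤ) ∣ v i) ∨ (fun i => v i / 2) ∈ τ})
    (hv' : ¬ ∀ i, (2 : ℤ) ∣ v i) :
    PathIn triGraph {v : Site 2 | (∀ i, (2 : ℤ) ∣ v i) ∨ (fun i => v i / 2) ∈ τ} v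
      (fun i => 2 * (v i / 2) + 1) := by
  have hvτ : (fun i => v i / 2) ∈ τ := hv.resolve_left hv'
  have hne : ¬ (v 0 % 2 = 0 ∧ v 1 % 2 = 0) := fun h => hv' fun i => by
    fin_cases i
    · exact Int.dvd_of_emod_eq_zero h.1
    · exact Int.dvd_of_emod_eq_zero h.2
  refine PathIn.of_eq_or_adj hv ?_ (siteEnd_eq_or_adj_of_coords' rfl rfl rfl rfl ?_)
  · rw [siteEnd_ctr_mem_blowup_iff]
    exact hvτ
  · have h0 := Int.emod_two_eq_zero_or_one (v 0)
    have h1 := Int.emod_two_eq_zero_or_one (v 1)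
    omega

/-- **Corners.** The doubled vertex `2z` (always open) is adjacent to an open non-corner fine
site iff one of the three cells `z, z - e₀, z - e₁` around the original vertex `z` is in `τ`;
otherwise it is an isolated open fine site (all six fine neighbours closed), whose hexagon is a
dust loop of the blow-up. -/
theorem siteEnd_corner_isolated_iff (τ : SiteConfig (Site 2)) (z : Site 2) :
    (∀ w : Site 2, triGraph.Adj (fun i => 2 * z i) w →
      w ∉ {v : Site 2 | (∀ i, (2 : ℤ) ∣ v i) ∨ (fun i => v i / 2) ∈ τ}) ↔
      z ∉ τ ∧ (z - Pi.single 0 1) ∉ τ ∧ (z - Pi.single 1 1) ∉ τ := by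
  have heven : ∀ i, (2 : ℤ) ∣ (fun i => 2 * z i : Site 2) i := fun i => ⟨z i, rfl⟩
  have e00 : (z - Pi.single 0 1 : Site 2) 0 = z 0 - 1 := by simp
  have e01 : (z - Pi.single 0 1 : Site 2) 1 = z 1 := by simp
  have e10 : (z - Pi.single 1 1 : Site 2) 0 = z 0 := by simp
  have e11 : (z - Pi.single 1 1 : Site 2) 1 = z 1 - 1 := by simp
  have hz0 : (fun i => 2 * z i : Site 2) 0 = 2 * z 0 := rfl
  have hz1 : (fun i => 2 * z i : Site 2) 1 = 2 * z 1 := rfl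
  constructor
  · intro h
    refine ⟨fun hz => ?_, fun hz => ?_, fun hz => ?_⟩
    · have hm0 : (![2 * z 0 + 1, 2 * z 1] : Site 2) 0 = 2 * z 0 + 1 := rfl
      have hm1 : (![2 * z 0 + 1, 2 * z 1] : Site 2) 1 = 2 * z 1 := rfl
      refine h (![2 * z 0 + 1, 2 * z 1]) (siteEnd_adj_of_coords' hz0 hz1 hm0 hm1 (by omega))
        (Or.inr ?_)
      rwa [siteEnd_half_eq_of_coords (a := z) (by rw [hm0]; omega) (by rw [hm1]; omega)]
    · have hm0 : (![2 * z 0 - 1, 2 * z 1] : Site 2) 0 = 2 * z 0 - 1 := rfl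
      have hm1 : (![2 * z 0 - 1, 2 * z 1] : Site 2) 1 = 2 * z 1 := rfl
      refine h (![2 * z 0 - 1, 2 * z 1]) (siteEnd_adj_of_coords' hz0 hz1 hm0 hm1 (by omega))
        (Or.inr ?_)
      rwa [siteEnd_half_eq_of_coords (a := z - Pi.single 0 1) (by rw [e00, hm0]; omega)
        (by rw [e01, hm1]; omega)]
    · have hm0 : (![2 * z 0, 2 * z 1 - 1] : Site 2) 0 = 2 * z 0 := rfl
      have hm1 : (![2 * z 0, 2 * z 1 - 1] : Site 2) 1 = 2 * z 1 - 1 := rfl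
      refine h (![2 * z 0, 2 * z 1 - 1]) (siteEnd_adj_of_coords' hz0 hz1 hm0 hm1 (by omega))
        (Or.inr ?_)
      rwa [siteEnd_half_eq_of_coords (a := z - Pi.single 1 1) (by rw [e10, hm0]; omega)
        (by rw [e11, hm1]; omega)]
  · rintro ⟨h₀, h₁, h₂⟩ w hw hwA
    have hwodd : ¬ ∀ i, (2 : ℤ) ∣ w i := fun hw' => siteEnd_not_adj_of_even heven hw' hw
    have hwτ : (fun i => w i / 2) ∈ τ := hwA.resolve_left hwodd
    rcases siteEnd_half_of_adj_even hw.symm heven with hc | hc | hc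
    · refine h₀ ?_
      rwa [siteEnd_half_eq_of_coords (a := z) (by omega) (by omega)] at hwτ
    · refine h₁ ?_
      rwa [siteEnd_half_eq_of_coords (a := z - Pi.single 0 1) (by omega) (by omega)] at hwτ
    · refine h₂ ?_
      rwa [siteEnd_half_eq_of_coords (a := z - Pi.single 1 1) (by omega) (by omega)] at hwτ

end Summit.CriticalPhenomena.CardyFormulaZ2.Cruxes.LoopLimitZ2EqT.HexSegment

end
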